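import Mathlib
import HarnessLib
import Summits.HubbardSuperconductivity.HubbardSuperconductivity.Theorems.KLProgrammeKLRegimeEngineTowerBlockZeroReadoutF
import Summits.HubbardSuperconductivity.HubbardSuperconductivity.Theorems.KLProgrammeKLRegimeEngineTowerBlockZeroIncrLevStepFKlEng
import Summits.HubbardSuperconductivity.HubbardSuperconductivity.Theorems.KLProgrammeKLRegimeKernelNormsLevelsFloorTracks

/-!
# Route `KLProgramme` — crux K3 ENGINE (stmt-HubbardSuperconductivity-20437 `KLRegimeEngineV17F2`), stub (b) v2, THE LEVELS PACKAGE (ℓ), located item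
# «(ℓ)-READOUT-F», (R332)(D)(α′) RO-3′ CLOSER ON THE FLOW FRAME: `KernelNormsLevels … (K_n) j` FOR `1 ≤ j ≤ d` FROM THE LEVEL-`0` DATUM, the block-`0`
# step's data DISCHARGED from the model (cell gate-hubbard-kl, seat gate-hubbard-kl-p3 g22; block-`0` twin of p4 g20's closer‴_klEng
# `kernelNormsLevels_readoutF_klEng` (…TowerLevReadoutCloseFLinkKlEng): `readoutLevF_le_levelsRHS_blockZero_sharp` (…TowerBlockZeroReadoutF) at
# `K := klFlowFrameU … n` ∘ `blockZeroIncrLevF_le_kitStep_klEng` (…TowerBlockZeroIncrLevStepFKlEng) ∘ `kernelNormsLevels_of_floorTracks`)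

WHY.  The assembly `kernelNormsLevels_all_klEng` (k3c3-p2 g16, p691583) reads the levels `j < d` of stub (b)'s clause `∀ j ≤ n, KernelNormsLevels … (K_n) j`
through RO-3 (`kernelNormsLevels_uvF_of_wgridStep`), i.e. modulo grid-step rows at `(Λ_j, F_j)` for every `j < d` — among them the weighted analysis-overlap
rows of `E(F_j[K_n])·S_{4M}`, located as NOT uniformly dischargeable on `K_n` for `j ≪ n` (p3 g21, STATUS l.10537).  (α′) replaces them, for `1 ≤ j ≤ d`,
by the LEVEL-`0` datum (`𝒱_1[K_n]` at `F_0`: base rows `Nb` with their floor-unit law at `J = 0`, and the Chernoff / import rows of the floor array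
`klTowerMuLevF … (K_n) 1 1 m` — the F7 / `…srcWindow_zero` class, grid rows = klE4X0) plus ONE thick block `(Λ_j, Λ_1]` whose eight data are DISCHARGED
here from the model (`linkDataBlockZeroF_klEng` inside `blockZeroIncrLevF_le_kitStep_klEng`; constants pinned by the SAME equations as closer‴_klEng:
`κ̄ = √(2Cκe₀)`, `ᾱ = Cb·(M/β)·4^d/e₀`, `c̄r = 81·CJ·M/β`, `c̄c = 162·CJ·M/β`, `W Z σ Φ ψ τ` as the link pins them).  What stays hypothetical, by
owner: `Z^{K_n}_{Λ_1} ≠ 0` (E1's Z-chain; p3 g21's `exists_partitionFn_scaleOne_ne_zero` under its own doors), the level-`0` datum rows and the imports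
`ι₁ ι₂ ι₃` / profile `(A′, Q′)` [E1 / level-`0` numerics], the five smallness rows and the `CE` threshold [numerics], the degree caps, the six-leg cell at
level `j`.  Level `j = 0` itself stays RO-3 at `(Λ_0, F_0)`.

* **`kernelNormsLevels_blockZeroF_klEng (d c″)`** — `∃ C_inc > 0, D_inc ≥ 1, ∀ R, R.WF2 → ∃ c₃′ U₀′ > 0, ∃ Cκ Cb CJ > 0`, under `linkDataBlockZeroF_klEng`'s door
  prefix (+ `c ≤ c₃′`, `U ≤ U₀′`): for every `1 ≤ j ≤ d`, `j ≤ n`, cap `D ≥ 3`, the rows above ⊢ `KernelNormsLevels L M P Qe β U μ (klFlowFrameU L M β U μ n) j`.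
Composition of landed theorems only; nothing about the model is asserted beyond them; nothing asserts (ℓ), any stub, K3 or superconductivity.
References: BGM 2006 §2.8 (2.76)–(2.84), (2.93)–(2.98), Lemma 2.5, §3 (3.2)–(3.8) [cite: BenfattoGiulianiMastropietro2006].
-/

noncomputable section

namespace Summit.HubbardSuperconductivity.HubbardSuperconductivity.Theorems.EngineV8

set_option linter.dupNamespace false -- summit = problem name (single-conjunct summit), D-0017

open Classical
open Real Finset Literature.MathematicalPhysics.QuantumLattice Literature.Probability.LatticeModels GrassmannAlgebra
open Literature.Probability.LatticeModels.BattleFederbush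
open Literature.MathematicalPhysics.QuantumLattice.FermiRG
open Summit.HubbardSuperconductivity.HubbardSuperconductivity.Theorems.KLProgrammeLegKernels
open Summit.HubbardSuperconductivity.HubbardSuperconductivity.Theorems.KLRegimeSplit
open Summit.HubbardSuperconductivity.HubbardSuperconductivity.Theorems.KLRegimeWick
open Summit.HubbardSuperconductivity.HubbardSuperconductivity.Theorems.TorusFourierL2
open Summit.HubbardSuperconductivity.HubbardSuperconductivity.Theorems.DispersionFlow

variable {L M : ℕ} [NeZero L] [NeZero M]

set_option maxHeartbeats 400000 in -- one ~80-binder composition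
/-- **`KernelNormsLevels` AT A LEVEL `1 ≤ j ≤ d` OF BLOCK `0` ON THE FLOW FRAME, FROM THE LEVEL-`0` DATUM, THICK-BLOCK DATA DISCHARGED** ((α′) RO-3′
closer; the block-`0` twin of closer‴_klEng): `readoutLevF_le_levelsRHS_blockZero_sharp` at `K_n` with its born-step row supplied by
`blockZeroIncrLevF_le_kitStep_klEng` (constants pinned by equations, instantiate with `rfl`), read on the floor tracks by `kernelNormsLevels_of_floorTracks`.
See the module docstring for the binders. [cite: BenfattoGiulianiMastropietro2006, §2.8 (2.76)-(2.84), Lemma 2.5 (2.98), §3 (3.2)-(3.8)] -/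
theorem kernelNormsLevels_blockZeroF_klEng (d : ℕ) (c'' : ℝ) (hc'' : 0 < c'') :
    ∃ Cinc Dinc : ℝ, 0 < Cinc ∧ 1 ≤ Dinc ∧
    ∀ R : RenConsts, R.WF2 → ∃ c₃' : ℝ, 0 < c₃' ∧ ∃ U₀' : ℝ, 0 < U₀' ∧
      ∃ Cκ Cb CJ : ℝ, 0 < Cκ ∧ 0 < Cb ∧ 0 < CJ ∧
      ∀ (G : GeoConsts) (P : SplitConsts) (Qh : EngConsts) (c : ℝ), P.WF → 0 < c → c ≤ klEngC₃6 P R → c ≤ c₃' →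
      ∀ μ ∈ klWindowC, ∀ U : ℝ, 0 < U → U ≤ klEngU₀9 P R c → U ≤ U₀' → c'' * U ≤ 1 → ∀ β : ℝ, klBetaMin ≤ β → β ≤ Real.exp (c / U ^ 2) →
      ∀ (L M : ℕ) [NeZero L] [NeZero M], klEngL₃ β U ≤ L → klEngM₃ β U L ≤ M →
      ∀ n : ℕ, 1 ≤ n → n ≤ nScales β + 1 → IsKLRegime U c (-(n : ℤ)) →
        HistP klPredsV17F2 L M G P Qh R β U μ 0 n → FrameOK R U (nScales β) μ (klFlowFrameU L M β U μ n) →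
        (∀ m, 1 ≤ m → m < n → FlowPieceOscAt L M c'' β U μ m) →
      -- the read-out level `1 ≤ j ≤ d` of block `0`, the degree cap
      ∀ j D : ℕ, 1 ≤ j → j ≤ d → j ≤ n → 3 ≤ D →
      -- the partition function at `Λ_1` on the flow frame (E1's Z-chain / `exists_partitionFn_scaleOne_ne_zero`)
      hubbardEffPartitionFnCT L M β U μ 0 (klFlowFrameU L M β U μ n) (klScale klE0 1) ≠ 0 →
      ∀ (B Ab Qb : ℝ), 1 ≤ B → 0 ≤ Ab → 0 ≤ Qb →
      -- the level-`0` datum: `𝒱_1[K_n]` at `F_0` and its unit law at `J = 0`, at `λ = B·ε_j`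
      ∀ Nb : Fin 5 → ℕ → ℝ, (∀ t p, 0 ≤ Nb t p) →
        (∀ (t : Fin 5) (p : ℕ) (Ωe' : Fin (2 * p) → Option (SectorLeg (sectorCount 0))), levelCount Ωe' = (t : ℕ) + 1 →
          klLevNormOf L M β μ (klFlowFrameU L M β U μ n) 0 (2 * p) (klTowerInput L M β U μ (klFlowFrameU L M β U μ n) 1 1) Ωe' ≤ Nb t p) →
        (∀ (t : Fin 5) (p : ℕ), 3 ≤ p → Nb t p / klLevUnitF β M t p 0 ≤ Ab * (B * epsCoupling P U j) ^ (p - 1) * Qb ^ p) →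
      -- the block-`0` kit cap at the input label set
      Fintype.card (SpaceTimeIdx L M × SectorLeg (sectorCount 0)) / 2 ≤ D →
      -- the thick-block data DISCHARGED (`blockZeroIncrLevF_le_kitStep_klEng`): the four constants pinned, then the law's six names pinned (equational binders)
      ∀ (κb αb crb ccb : ℝ), κb = Real.sqrt (2 * Cκ * klE0) → αb = Cb * ((M : ℝ) / β) * (4 : ℝ) ^ d / klE0 →
        crb = 81 * CJ * M / β → ccb = 162 * CJ * M / β →
      ∀ (W Z σ Φ ψ τ : ℝ), W = 64 * (27 : ℝ) ^ 4 * exp 2 * crb / ccb → Z = exp 4 * ccb ^ 2 * imagTimeWeight β M ^ 2 / 8 →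
        σ = κb ^ 2 / (exp 4 * ccb ^ 2) → Φ = 9 * αb * ccb / ((27 : ℝ) ^ 5 * exp 1 * κb ^ 2 * crb) → ψ = exp 4 * ccb ^ 2 / κb ^ 2 →
        τ = exp 2 * κb ^ 2 / ccb ^ 2 →
      -- the Chernoff data of the level-`0` datum in floor units and the imports (E1 / level-`0` numerics)
      ∀ (A' Q' ι₁ ι₂ ι₃ : ℝ), 0 ≤ A' → 0 < Q' →
      (∀ m, 4 ≤ m → m ≤ D → W * Z ^ m * klTowerMuLevF L M β U μ (klFlowFrameU L M β U μ n) 1 1 m ≤ A' * (B * epsCoupling P U j) ^ (m - 1) * Q' ^ m) →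
      W * Z ^ 3 * klTowerMuLevF L M β U μ (klFlowFrameU L M β U μ n) 1 1 3 ≤ ι₃ * (B * epsCoupling P U j) ^ 2 →
      W * Z ^ 1 * klTowerMuLevF L M β U μ (klFlowFrameU L M β U μ n) 1 1 1 ≤ ι₁ * (B * epsCoupling P U j) →
      W * Z ^ 2 * klTowerMuLevF L M β U μ (klFlowFrameU L M β U μ n) 1 1 2 ≤ ι₂ * (B * epsCoupling P U j) →
      -- the five smallness rows at `(A′, Q′, λ)` (numerics)
      4 * σ * (B * epsCoupling P U j) * Q' < 1 → 2 * (B * epsCoupling P U j) * τ * Q' ≤ 1 → exp 1 * τ * (B * epsCoupling P U j) * Q' < 1 →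
      Φ * (τ * (ι₁ * (B * epsCoupling P U j) + ι₂ / (2 * Q') + ι₃ / (4 * Q' ^ 2) + A' * Q' / 4)) < 1 →
      Φ * (exp 1 * τ * (ι₁ * (B * epsCoupling P U j)) + (exp 1 * τ) ^ 2 * (ι₂ * (B * epsCoupling P U j)) +
          (exp 1 * τ) ^ 3 * (ι₃ * (B * epsCoupling P U j) ^ 2) +
        A' * (exp 1 * τ * Q') * ((exp 1 * τ * (B * epsCoupling P U j) * Q') ^ 3 / (1 - exp 1 * τ * (B * epsCoupling P U j) * Q'))) < 1 →
      -- the read-out constants (equational binders), the public constant's threshold, the field cap, the six-leg cell at level `j`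
      ∀ (Aro Qro Qtot Atot : ℝ), Aro = Cinc * Ab → Qro = Dinc * Qb → Qtot = Dinc * max 1 (max Qro (max (4 * Q') (2 * τ * ψ * Q'))) →
        Atot = Aro + Cinc * (A' * (4 * σ * (B * epsCoupling P U j) * Q' / (1 - 4 * σ * (B * epsCoupling P U j) * Q')) +
          exp 1 * (τ * (ι₁ * (B * epsCoupling P U j) + ι₂ / (2 * Q') + ι₃ / (4 * Q' ^ 2) + A' * Q' / 4)) *
            (Φ * (τ * (ι₁ * (B * epsCoupling P U j) + ι₂ / (2 * Q') + ι₃ / (4 * Q' ^ 2) + A' * Q' / 4)) /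
              (1 - Φ * (τ * (ι₁ * (B * epsCoupling P U j) + ι₂ / (2 * Q') + ι₃ / (4 * Q' ^ 2) + A' * Q' / 4)))) / (2 * τ * Q')) →
      ∀ Qe : EngConsts, Qtot * imagTimeWeight β M ^ 2 * B * max 1 (Atot / imagTimeWeight β M) ≤ Qe.CE →
      Fintype.card (HubbardFieldIdx L M) ≤ 2 * D + 1 →
      (∀ Ωe : Fin (2 * 3) → Option (SectorLeg (sectorCount j)), levelCount Ωe = 1 →
        klAnisoLegKernelNormAt L M β U μ (klFlowFrameU L M β U μ n) klE0 j (2 * 3) Ωe ≤ Qe.CE ^ 3 * (epsCoupling P U j) ^ 2 * (2 : ℝ) ^ ((4 : ℤ) * j)) →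
      KernelNormsLevels L M P Qe β U μ (klFlowFrameU L M β U μ n) j := by
  obtain ⟨Cinc, Dinc, hCinc, hDinc, hF⟩ := readoutLevF_le_levelsRHS_blockZero_sharp
  refine ⟨Cinc, Dinc, hCinc, hDinc, fun R hR2 => ?_⟩
  obtain ⟨c₃, hc₃, U₀, hU₀, hF'⟩ := hF R hR2
  obtain ⟨Cκ, Cb, CJ, hCκ, hCb, hCJ, hS⟩ := blockZeroIncrLevF_le_kitStep_klEng d R c'' hc''
  refine ⟨c₃, hc₃, U₀, hU₀, Cκ, Cb, CJ, hCκ, hCb, hCJ, ?_⟩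
  intro G P Qh c hP hc hc6 hc₃' μ hμ U hU hU9 hU₀' hcU β hβmin hβc L M _ _ hL3 hM3 n hn1 hnN hreg hhist hfr hosc j D hj1 hjd hjn hD3 hZ1
    B Ab Qb hB hAb hQb Nb hNb0 hcar hlawb hDcap κb αb crb ccb hκb hαb hcrb hccb W Z σ Φ ψ τ hW hZ hσ hΦ hψ hτ
    A' Q' ι₁ ι₂ ι₃ hA'0 hQ'0 hprof hprof3 himp₁ himp₂ hx₁ hx₂ hx₃ hy hθ Aro Qro Qtot Atot hAro hQro hQtot hAtot Qe hCE hcard hsix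
  have he : (0 : ℝ) < klE0 := by norm_num [klE0]
  have hβ : 0 < β := KLRegimeSplit.pos_of_klBetaMin_le hβmin
  have hM0 : (0 : ℝ) < M := Nat.cast_pos.2 (Nat.pos_of_ne_zero (NeZero.ne M))
  have hK1 : 1 ≤ P.Klam := hP.1
  have hK0 : 0 < P.Klam := lt_of_lt_of_le one_pos hK1
  have hjN : j ≤ nScales β + 1 := hjn.trans hnN
  have hx : 0 < imagTimeWeight β M := imagTimeWeight_pos_of_pos (M := M) hβ
  -- positivity of the pinned constants
  have hκb0 : 0 < κb := by rw [hκb]; exact Real.sqrt_pos.2 (by positivity)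
  have hαb0 : 0 < αb := by rw [hαb]; positivity
  have hcrb0 : 0 < crb := by rw [hcrb]; positivity
  have hccb0 : 0 < ccb := by rw [hccb]; positivity
  have hW0 : 0 < W := by rw [hW]; positivity
  have hZ0 : 0 < Z := by rw [hZ]; positivity
  have hσ0 : 0 ≤ σ := by rw [hσ]; positivity
  have hΦ0 : 0 ≤ Φ := by rw [hΦ]; positivity
  have hψ0 : 0 ≤ ψ := by rw [hψ]; positivity
  have hτ0 : 0 < τ := by rw [hτ]; positivity
  -- the block-`0` born step on `K_n`, data discharged
  have hstep := hS G P Qh c hP hR2 hc hc6 μ hμ U hU hU9 hcU β hβmin hβc L M hL3 hM3 n hn1 hnN hreg hhist hfr hosc j hj1 hjd hjn hZ1 D hDcap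
    κb αb crb ccb hκb hαb hcrb hccb
  have hborn : ∀ N : ℕ, 1 ≤ N → Φ * towerV D τ (fun m => W * Z ^ m * klTowerMuLevF L M β U μ (klFlowFrameU L M β U μ n) 1 1 m) < 1 →
      ∀ (t : Fin 5) (q : ℕ) (Ωe : Fin (2 * q + 1 + 1) → Option (SectorLeg (sectorCount 1))), levelCount Ωe = (t : ℕ) + 1 →
      klLevNormOf L M β μ (klFlowFrameU L M β U μ n) 1 (2 * q + 1 + 1)
          (klEffectiveAction L M β U μ (klFlowFrameU L M β U μ n) klE0 j - klTowerInput L M β U μ (klFlowFrameU L M β U μ n) 1 1) Ωe /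
          klLevUnitF β M t (q + 1) 1 ≤
        towerFO D σ (fun m => W * Z ^ m * klTowerMuLevF L M β U μ (klFlowFrameU L M β U μ n) 1 1 m) (q + 1) +
          ∑ n' ∈ Icc 2 N, exp 1 * Φ ^ (n' - 1) * ψ ^ (q + 1) *
            towerS D τ (fun m => W * Z ^ m * klTowerMuLevF L M β U μ (klFlowFrameU L M β U μ n) 1 1 m) n' (q + 1) +
          ψ ^ (q + 1) * exp 1 * towerV D τ (fun m => W * Z ^ m * klTowerMuLevF L M β U μ (klFlowFrameU L M β U μ n) 1 1 m) *
            (Φ * towerV D τ (fun m => W * Z ^ m * klTowerMuLevF L M β U μ (klFlowFrameU L M β U μ n) 1 1 m)) ^ N /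
            (1 - Φ * towerV D τ (fun m => W * Z ^ m * klTowerMuLevF L M β U μ (klFlowFrameU L M β U μ n) 1 1 m)) := by
    subst hW hZ hσ hΦ hψ hτ
    exact hstep
  -- the public constant is nonnegative (from the threshold)
  have hDinc0 : 0 < Dinc := lt_of_lt_of_le one_pos hDinc
  have hQtot0 : 0 ≤ Qtot := by rw [hQtot]; exact mul_nonneg hDinc0.le (zero_le_one.trans (le_max_left _ _))
  have hCE0 : 0 ≤ Qe.CE := by
    refine le_trans ?_ hCE
    have : 0 ≤ max 1 (Atot / imagTimeWeight β M) := zero_le_one.trans (le_max_left _ _)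
    positivity
  -- the read-out on every floor track, then the tracks package
  have hro : ∀ (t : Fin 5) (p : ℕ), 3 ≤ p → p ≤ D → 7 ≤ 2 * p + (t : ℕ) →
      ∀ Ωe : Fin (2 * p) → Option (SectorLeg (sectorCount j)), levelCount Ωe = (t : ℕ) + 1 →
      klLevNormOf L M β μ (klFlowFrameU L M β U μ n) j (2 * p) (klEffectiveAction L M β U μ (klFlowFrameU L M β U μ n) klE0 j) Ωe ≤
        Qe.CE ^ p * epsCoupling P U j ^ (p - 1) * (2 : ℝ) ^ ((3 * (p : ℤ) - 5) * j) * (((2 : ℝ) ^ j)⁻¹) ^ levelGainExp ((t : ℕ) + 1) :=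
    fun t p hp hpD hpt Ωe hlev =>
      hF' P c hP hc hc6 hc₃' μ hμ U hU hU9 hU₀' β hβmin hβc (klFlowFrameU L M β U μ n) hfr L M hL3 hM3 j D hj1 hjN hD3 B Ab Qb hB hAb hQb
        Nb hNb0 hcar hlawb W Z σ Φ ψ τ A' Q' ι₁ ι₂ ι₃ hW0 hZ0 hσ0 hΦ0 hψ0 hτ0 hA'0 hQ'0 hprof hprof3 himp₁ himp₂ hx₁ hx₂ hx₃ hy hθ hborn
        Aro Qro Qtot Atot hAro hQro hQtot hAtot Qe.CE hCE t p hp hpD hpt Ωe hlev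
  exact kernelNormsLevels_of_floorTracks hβ.le hCE0 hK0.le hD3 hcard
    (fun t _ p hp hpD hpt Ωe hc => by rw [← klLevNormOf_klEffectiveAction]; exact hro t p hp hpD hpt Ωe hc) hsix

end Summit.HubbardSuperconductivity.HubbardSuperconductivity.Theorems.EngineV8

end
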